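import Mathlib
import HarnessLib.Audit
import Summits.PneNP.PneNP.Theorems.PstarNorUnitExcCore

/-!
# Forcing a chord against a SHIFTED constraint form: trivial, (EQ), or a CONS-T unit with a gadget (E2 node N2X; prover-1 g21)

FRONTIER range-avoidance ladder, rung F-N3 (`stmt-PneNP-19007`), cell `pnp-ideate` (`PstarGateNodesX.GateCasePUnitsX`); restricted-model proof
complexity — nothing here bears on `P` versus `NP`.

The engine of `PstarNorUnitEQ1Three.eq1_three`, packaged for ANY quadratic `q` whose polar form is a `polarDir I B m` — in node N2X the first
constraint's form shifted by the (affine) gate coefficient, `q_{(0,1)} + ℓ + const`, which is not a `qDir` itself.  For a chord `e` of well-formed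
bridge data on a pure `(r,3/2)`-expanding instance with simple overlaps (`#(J₀ ∪ G₁ ∪ G₂) ≤ r`, `e ∉ G₁ ∪ G₂`) and the containment
`Z(q) ⊆ {Q_{D e} = c₀}`:

* `nor_unit_shifted` — `PstarNorUnitEQ1Tools.nor_unit_of_dir_const` verbatim with `qDir I B m` replaced by `q` (only the polar identity is used);
* `forced_cases_shifted` — **`q ≡ 1`, or (EQ) `Q_{D e} = q + κ`, or `D e` is a CONS-T pair `{j₁, j₂}` (disjoint AND pairs, literals
  `σ ∈ j₁`, `τ ∈ j₂`) with a GADGET `g ∈ T₁ ∪ freeMon G₁ ∪ T₂ ∪ freeMon G₂` holding `σ` and `τ`** (`PstarForcing.forcing_cases` with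
  `rank_four_of_wf`; (EXC) through `PstarNorUnitExcCore.exc_unit_core`, (NOR) through `nor_unit_shifted`).
-/

set_option linter.dupNamespace false -- `Summit.PneNP.PneNP.…`: summit = sub-problem name (D-0017 single-conjunct layout)

open Finset Module Literature.Computability.Complexity
open Summit.PneNP.PneNP.Theorems.PstarSALevel (varSet bdry BoundaryExpanding SimpleOverlap)
open Summit.PneNP.PneNP.Theorems.PstarGapLinearised (andPair andPair_subset_varSet)
open Summit.PneNP.PneNP.Theorems.PstarChordEndgameTools (mem_andPair_iff)
open Summit.PneNP.PneNP.Theorems.PstarCubeIdeals (IsAffineFn)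
open Summit.PneNP.PneNP.Theorems.PstarQuadRank (rad)
open Summit.PneNP.PneNP.Theorems.PstarRankRigidityTwo (linPart symForm symForm_apply linPart_apply affine_mul_polar)
open Summit.PneNP.PneNP.Theorems.PstarForcing (polar_unique forcing_cases)
open Summit.PneNP.PneNP.Theorems.PstarProductRank (qform polar)
open Summit.PneNP.PneNP.Theorems.PstarPathRank (AndAdj polar_basis)
open Summit.PneNP.PneNP.Theorems.PstarChordBridge (BridgeData)
open Summit.PneNP.PneNP.Theorems.PstarReadSumset (V2)
open Summit.PneNP.PneNP.Theorems.PstarChordBridgeForcing (freeMon freePolar rank_four_of_wf qform_add')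
open Summit.PneNP.PneNP.Theorems.PstarChordBridgeBasis (qDir polarDir)
open Summit.PneNP.PneNP.Theorems.PstarNorUnitCases (mem_of_andAdj)
open Summit.PneNP.PneNP.Theorems.PstarNorUnitNA (nor_unit_na)
open Summit.PneNP.PneNP.Theorems.PstarNorUnitBridge (xor_not_mem_bdry_of_even)
open Summit.PneNP.PneNP.Theorems.PstarNorUnitDir (exists_realiser_of_polarDir)
open Summit.PneNP.PneNP.Theorems.PstarChordBridgeCorner (andAdj_iff_mem)
open Summit.PneNP.PneNP.Theorems.PstarNorUnitExcCore (exc_unit_core)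

namespace Summit.PneNP.PneNP.Theorems.PstarGateForcedShifted

variable {n m : ℕ}

/-- **The NOR case against a shifted form is a CONS-T unit** (`nor_unit_of_dir_const` for any `q` with polar form `polarDir I B m`). -/
theorem nor_unit_shifted (I : LocalMap 4 n m) (hI : I.IsPure xorAndPred) (hS : SimpleOverlap I) {r : ℕ} (hB : BoundaryExpanding r I)
    {B : BridgeData n m} (hW : B.WF I) (hr : (B.J₀ ∪ B.G₁ ∪ B.G₂).card ≤ r) {e : Fin m} (he : e ∈ B.N) (heG : e ∉ B.G₁ ∪ B.G₂) (mv : V2)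
    {q : (Fin n → ZMod 2) → ZMod 2} (hqB : ∀ x w, q (x + w) = q x + q w + q 0 + polarDir I B mv x w)
    {a b : Fin n → ZMod 2} {β α ζ : ZMod 2}
    (hq : ∀ x, q x = (polarDir I B mv x b + β) * (polarDir I B mv x a + α) + ζ)
    {m₁ m₂ : (Fin n → ZMod 2) → ZMod 2} (hm₁ : IsAffineFn m₁) (hm₂ : IsAffineFn m₂) {c : ZMod 2}
    (hQ : ∀ x, qform (B.D e) (fun j => I.vars j 2) (fun j => I.vars j 3) x + c =
      (polarDir I B mv x b + β + 1) * m₁ x + (polarDir I B mv x a + α + 1) * m₂ x) :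
    ∃ j₁ j₂ : Fin m, ∃ σ τ : Fin n, j₁ ≠ j₂ ∧ B.D e = {j₁, j₂} ∧ Disjoint (andPair I j₁) (andPair I j₂) ∧ σ ∈ andPair I j₁ ∧ τ ∈ andPair I j₂ ∧
      (∀ v : Fin n, (polarDir I B mv (Pi.single v 1) b ≠ 0 ∨ polarDir I B mv (Pi.single v 1) a ≠ 0) ↔ (v = σ ∨ v = τ)) ∧
      ∃ g ∈ B.T₁ ∪ freeMon I B.N B.G₁ ∪ (B.T₂ ∪ freeMon I B.N B.G₂), σ ∈ andPair I g ∧ τ ∈ andPair I g := by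
  classical
  set fP := polarDir I B mv with hfP
  have haff : ∀ (y : Fin n → ZMod 2) (k : ZMod 2), IsAffineFn (fun x => fP x y + k) := by
    intro y k x w
    show fP (x + w) y + k = fP x y + k + (fP w y + k) + (fP 0 y + k)
    rw [map_add, LinearMap.add_apply, map_zero, LinearMap.zero_apply, zero_add]
    generalize fP x y = s; generalize fP w y = t
    revert s t k; decide
  have hμ₁ : IsAffineFn (fun x => fP x b + (β + 1)) := haff b (β + 1)
  have hμ₂ : IsAffineFn (fun x => fP x a + (α + 1)) := haff a (α + 1)
  have hlb : IsAffineFn (fun x => fP x b + β) := haff b β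
  have hla : IsAffineFn (fun x => fP x a + α) := haff a α
  have e3 : ∀ s k : ZMod 2, s + k + k = s := by decide
  have lin : ∀ {y : Fin n → ZMod 2} {k : ZMod 2} (h : IsAffineFn (fun x => fP x y + k)) (x : Fin n → ZMod 2), linPart h x = fP x y := by
    intro y k h x
    rw [linPart_apply]
    show fP x y + k + (fP 0 y + k) = fP x y
    rw [map_zero, LinearMap.zero_apply, zero_add]
    exact e3 _ _
  have hQ' : ∀ x, qform (B.D e) (fun j => I.vars j 2) (fun j => I.vars j 3) x + c =
      (fun x => fP x b + (β + 1)) x * m₁ x + (fun x => fP x a + (α + 1)) x * m₂ x := by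
    intro x; rw [hQ x]; simp only [add_assoc]
  have hpol : fP = symForm (linPart hlb) (linPart hla) := by
    refine polar_unique (Q := q) hqB fun x w => ?_
    rw [hq, hq x, hq w, hq 0, affine_mul_polar hlb hla]
    generalize (fP x b + β) * (fP x a + α) = s; generalize (fP w b + β) * (fP w a + α) = s'
    generalize (fP 0 b + β) * (fP 0 a + α) = s₀; generalize symForm (linPart hlb) (linPart hla) x w = t
    generalize ζ = k
    revert s s' s₀ t k; decide
  set G : Finset (Fin m) := (B.T₁ ∪ freeMon I B.N B.G₁ ∪ (B.T₂ ∪ freeMon I B.N B.G₂)).filter fun g => g ∉ insert e (B.D e) with hGdef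
  have heD : e ∉ B.D e := fun h => (mem_sdiff.1 (hW.hD e he h)).2 he
  have hGd : Disjoint G (insert e (B.D e)) := by
    rw [Finset.disjoint_left]
    intro g hg
    exact (mem_filter.1 hg).2
  have hsub : insert e (B.D e) ∪ G ⊆ B.J₀ ∪ B.G₁ ∪ B.G₂ := by
    intro g hg
    rcases mem_union.1 hg with hg | hg
    · rcases mem_insert.1 hg with rfl | hg
      · exact mem_union_left _ (mem_union_left _ (hW.hN he))
      · exact mem_union_left _ (mem_union_left _ (mem_sdiff.1 (hW.hD e he hg)).1)
    · have hg' := (mem_filter.1 hg).1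
      rcases mem_union.1 hg' with hg' | hg' <;> rcases mem_union.1 hg' with hg' | hg'
      · exact mem_union_left _ (mem_union_left _ (mem_sdiff.1 (hW.hT₁ hg')).1)
      · exact mem_union_left _ (mem_union_right _ (mem_filter.1 hg').1)
      · exact mem_union_left _ (mem_union_left _ (mem_sdiff.1 (hW.hT₂ hg')).1)
      · exact mem_union_right _ (mem_filter.1 hg').1
  have hr' : (insert e (B.D e) ∪ G).card ≤ r := (card_le_card hsub).trans hr
  have hcyc := xor_not_mem_bdry_of_even I hI (hW.hDeven e he)
  have hrank := rank_four_of_wf I hI hS hB hW ((card_le_card (subset_union_left.trans subset_union_left)).trans hr) he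
  have hK : ∀ v w : Fin n, v ≠ w → ¬ AndAdj I (B.D e) v w →
      linPart hμ₁ (Pi.single v 1) * linPart hμ₂ (Pi.single w 1) + linPart hμ₁ (Pi.single w 1) * linPart hμ₂ (Pi.single v 1) = 1 →
        ∃ g ∈ G, v ∈ andPair I g ∧ w ∈ andPair I g := by
    intro v w hvw hna hdet
    rw [lin hμ₁, lin hμ₁, lin hμ₂, lin hμ₂] at hdet
    have hval : fP (Pi.single v 1) (Pi.single w 1) = 1 := by
      rw [hpol, symForm_apply, lin hlb, lin hlb, lin hla, lin hla]
      exact hdet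
    rw [hfP] at hval
    obtain ⟨g, hg, hvg, hwg⟩ := exists_realiser_of_polarDir I hI hS B mv hval
    refine ⟨g, mem_filter.2 ⟨hg, fun hge => ?_⟩, hvg, hwg⟩
    rcases mem_insert.1 hge with rfl | hgD
    · rcases mem_union.1 hg with h | h <;> rcases mem_union.1 h with h | h
      · exact (mem_sdiff.1 (hW.hT₁ h)).2 he
      · exact heG (mem_union_left _ (mem_filter.1 h).1)
      · exact (mem_sdiff.1 (hW.hT₂ h)).2 he
      · exact heG (mem_union_right _ (mem_filter.1 h).1)
    · refine hna ?_
      rw [mem_andPair_iff] at hvg hwg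
      rcases hvg with rfl | rfl <;> rcases hwg with rfl | rfl
      · exact absurd rfl hvw
      · exact ⟨g, hgD, Or.inl ⟨rfl, rfl⟩⟩
      · exact ⟨g, hgD, Or.inr ⟨rfl, rfl⟩⟩
      · exact absurd rfl hvw
  obtain ⟨j₁, j₂, σ, τ, hne, hDe, hdisj, hσ, hτ, hlit, g, hg, hσg, hτg⟩ :=
    nor_unit_na hI hS hB heD hGd hr' hcyc hμ₁ hμ₂ hm₁ hm₂ hQ' hK hrank
  refine ⟨j₁, j₂, σ, τ, hne, hDe, hdisj, hσ, hτ, fun v => ?_, g, (mem_filter.1 hg).1, hσg, hτg⟩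
  rw [← hlit v, lin hμ₁, lin hμ₂]


/-- **Forcing a chord against a shifted constraint form.**  See the module docstring. -/
theorem forced_cases_shifted (I : LocalMap 4 n m) (hI : I.IsPure xorAndPred) (hS : SimpleOverlap I) {r : ℕ} (hB : BoundaryExpanding r I)
    {B : BridgeData n m} (hW : B.WF I) (hr : (B.J₀ ∪ B.G₁ ∪ B.G₂).card ≤ r) {e : Fin m} (he : e ∈ B.N) (heG : e ∉ B.G₁ ∪ B.G₂) (mv : V2)
    {q : (Fin n → ZMod 2) → ZMod 2} (hqB : ∀ x w, q (x + w) = q x + q w + q 0 + polarDir I B mv x w) {c₀ : ZMod 2}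
    (hZ : ∀ x, q x = 0 → qform (B.D e) (fun j => I.vars j 2) (fun j => I.vars j 3) x = c₀) :
    (∀ x, q x = 1) ∨
    (∃ κ : ZMod 2, ∀ x, qform (B.D e) (fun j => I.vars j 2) (fun j => I.vars j 3) x = q x + κ) ∨
    (∃ j₁ j₂ : Fin m, ∃ σ τ : Fin n, j₁ ≠ j₂ ∧ B.D e = {j₁, j₂} ∧ Disjoint (andPair I j₁) (andPair I j₂) ∧ σ ∈ andPair I j₁ ∧ τ ∈ andPair I j₂ ∧
      ∃ g ∈ B.T₁ ∪ freeMon I B.N B.G₁ ∪ (B.T₂ ∪ freeMon I B.N B.G₂), σ ∈ andPair I g ∧ τ ∈ andPair I g) := by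
  classical
  have hJr : B.J₀.card ≤ r := (card_le_card (subset_union_left.trans subset_union_left)).trans hr
  have hrank := rank_four_of_wf I hI hS hB hW hJr he
  rcases forcing_cases hqB (qform_add' I (B.D e)) hrank hZ with h1 | ⟨κ, hκ⟩ | ⟨ν₁, ν₂, hν₁, hν₂, κ, h⟩ |
      ⟨a, b, -, hqf, m₁, m₂, hm₁, hm₂, hQf⟩
  · exact Or.inl h1
  · exact Or.inr (Or.inl ⟨κ, hκ⟩)
  · rcases exc_unit_core I hI hS hB hW hr he heG mv hqB hZ hν₁ hν₂ h with ⟨κ', hκ'⟩ | ⟨j₁, j₂, σ, τ, hne, hDe, hdisj, hσ, hτ, -, -, g, hg, hσg, hτg⟩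
    · exact Or.inr (Or.inl ⟨κ', hκ'⟩)
    · exact Or.inr (Or.inr ⟨j₁, j₂, σ, τ, hne, hDe, hdisj, hσ, hτ, g, hg, hσg, hτg⟩)
  · have hq' : ∀ x, q x = (polarDir I B mv x b + (q b + q 0)) * (polarDir I B mv x a + (q a + q 0)) + 1 := hqf
    obtain ⟨j₁, j₂, σ, τ, hne, hDe, hdisj, hσ, hτ, -, g, hg, hσg, hτg⟩ :=
      nor_unit_shifted I hI hS hB hW hr he heG mv hqB hq' hm₁ hm₂ (c := c₀) hQf
    exact Or.inr (Or.inr ⟨j₁, j₂, σ, τ, hne, hDe, hdisj, hσ, hτ, g, hg, hσg, hτg⟩)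

end Summit.PneNP.PneNP.Theorems.PstarGateForcedShifted
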